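import Literature.Computability.Cryptography.OneWayFunctions
import Literature.Computability.Complexity.PairProjections
import Literature.Computability.Complexity.MapFstMachine
import HarnessLib

/-!
# Non-uniform one-wayness implies one-wayness (proofs)

Sibling proof file of `OneWayFunctions.lean` (D-0014: named facts `def X : Prop` are discharged
as `theorem X_holds : X`). It discharges

* `Literature.CryptoQuantFine.IsOneWayNonuniform.isOneWay_holds : IsOneWayNonuniform.isOneWay` —
  a function that is one-way against non-uniform polynomial-time adversaries is (uniformly)
  one-way (axioms `propext`, `Classical.choice`, `Quot.sound`). This is Goldreich,
  *Foundations of Cryptography I* (2001), §2.2.5, **Proposition 2.2.7**: "If `f` is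
  non-uniformly one-way, then it is one-way. That is, if `f` satisfies Definition 2.2.6, then
  it also satisfies Definition 2.2.1."

## The printed proof and its rendering here

Goldreich proves Prop. 2.2.7 by converting a probabilistic polynomial-time inverter `A'` into a
polynomial-size circuit family: fix, for each `n`, a coin sequence `r_n` maximising the success
probability of `A'` and hardwire it ("in accordance with our meta-theorem, see §1.3.3":
non-uniformity subsumes randomness). In the tree, `IsOneWayNonuniform` (file
`OneWayFunctions.lean`) renders "polynomial-size circuits" as PPT adversaries **with
polynomial-length advice** (Goldreich 2001, §1.3.3), so a uniform PPT adversary is literally the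
special case of the *empty* advice `a n = []`, and no averaging is needed: given a PPT inverter
`A` for `f`, the advised adversary receives the pair `⟨a n, w⟩ = boolPair (a n) w`, where
`w = ⟨1ⁿ, f x⟩` is the input `A` expects, so it suffices to run `A` on the payload
`w = (boolUnpair ⟨a n, w⟩).2` of the advised input. No machine is programmed here; the file only
assembles tree results:

* `polyTimeComputable_advPayload` — the map `(z, r) ↦ ((boolUnpair z).2, r)` between the
  `boolPair` presentations of (input, coins) is polynomial time: it is `mapFstFn π₂` for the
  polynomial-time second projection `π₂ = (boolUnpair ·).2` (`boolUnpairSnd_mem_FP`,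
  `PairProjections.lean`; `mapFstFn_mem_FP`, `MapFstMachine.lean`).
* `IsPPT.dropAdvice` — the *payload adversary* `(z; r) ↦ A((boolUnpair z).2; r)` with coin
  budget `m ↦ coinLen_A (m - 2)` is PPT when `A` is (`PolyTimeComputable.comp_holds` and
  monotonicity of `ℕ`-polynomials); with empty advice, `|⟨ε, w⟩| = |w| + 2`, so on `⟨ε, w⟩` it
  has *the same output distribution* as `A` on `w` (same run, same number of coins —
  definitionally), whence `invertProbAdv_dropAdvice_nil : invertProbAdv f A' ε = invertProb f A`
  and `IsOneWayNonuniform.isOneWay_holds`.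

## References

* O. Goldreich, *Foundations of Cryptography I: Basic Tools*, CUP 2001, §2.2.5, Def. 2.2.6 and
  Prop. 2.2.7; §1.3.3 (non-uniform polynomial time as advice-taking machines).
* S. Arora, B. Barak, *Computational Complexity: A Modern Approach*, CUP 2009, §0.1 (pairing),
  Thm. 2.8 (proof: composition of polynomial-time machines), Def. 6.5 (advice).
-/

namespace Literature.Computability.Cryptography

open Filter Asymptotics _root_.Computability Complexity

/-- Evaluation of an `ℕ`-polynomial is monotone in the argument (as in
`TimeBoundsProofs.lean`, proved inline there). [folklore] -/
private theorem natPoly_eval_mono (p : Polynomial ℕ) {x y : ℕ} (hxy : x ≤ y) :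
    p.eval x ≤ p.eval y := by
  induction p using Polynomial.induction_on' with
  | add p q hp hq => simp only [Polynomial.eval_add]; exact Nat.add_le_add hp hq
  | monomial n c =>
    simp only [Polynomial.eval_monomial]
    exact Nat.mul_le_mul_left c (Nat.pow_le_pow_left hxy n)

/-- **Extracting the payload of an advised input is polynomial time**: the map
`(z, r) ↦ ((boolUnpair z).2, r)`, read and written through the `boolPair` presentation of
(input, coins), is `mapFstFn (boolUnpair ·).2`, polynomial time by `mapFstFn_mem_FP`
(`MapFstMachine.lean`) and `boolUnpairSnd_mem_FP` (`PairProjections.lean`), transported along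
the encoders with `mapFstFn_boolPair`. [Arora–Barak 2009, §0.1 (pairing), §1.3]
[cite: AroraBarak2009, §0.1] -/
theorem polyTimeComputable_advPayload :
    PolyTimeComputable (fun p : List Bool × List Bool => boolPair (id p.1) p.2)
      (fun p : List Bool × List Bool => boolPair (id p.1) p.2)
      (fun p : List Bool × List Bool => ((boolUnpair p.1).2, p.2)) := by
  obtain ⟨p, M, hM⟩ := mapFstFn_mem_FP boolUnpairSnd_mem_FP
  refine ⟨p, M, fun a => ?_⟩
  have h := hM (boolPair a.1 a.2)
  simp only [id, mapFstFn_boolPair] at h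
  exact h

/-- **The payload adversary is PPT.** For a PPT `A`, the randomized algorithm
`(z; r) ↦ A((boolUnpair z).2; r)` with coin budget `m ↦ coinLen_A (m - 2)` (the advised input
`⟨ε, w⟩ = 0 1 w` is two symbols longer than its payload `w`; for `m < 2`, lengths that do not
occur, the budget is `coinLen_A 0`) is PPT: its run is `uncurry A.run` after the polynomial-time
map of `polyTimeComputable_advPayload` (`PolyTimeComputable.comp_holds`), and
`coinLen_A (m - 2) ≤ p (m - 2) ≤ p m`. [Goldreich 2001, §1.3.3 (advice-taking machines) and
Prop. 2.2.7; Arora–Barak 2009, Thm. 2.8 (proof, composition)] [cite: Goldreich2001, §1.3.3] -/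
theorem IsPPT.dropAdvice {β : Type} {eb : β → List Bool} {A : RandAlg (List Bool) β}
    (hA : IsPPT A eb) :
    IsPPT ⟨fun z r => A.run (boolUnpair z).2 r, fun m => A.coinLen (m - 2)⟩ eb := by
  refine ⟨?_, ?_⟩
  · exact PolyTimeComputable.comp_holds hA.1 polyTimeComputable_advPayload
  · obtain ⟨p, hp⟩ := hA.2
    exact ⟨p, fun m => (hp (m - 2)).trans (natPoly_eval_mono p (Nat.sub_le m 2))⟩

/-- **Same success probability** ("without decreasing the success probability", Goldreich's
proof of Prop. 2.2.7): with the empty advice `a n = ε`, the advised inversion probability of the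
payload adversary equals the inversion probability of `A` — on `⟨ε, w⟩ = 0 1 w` it runs `A` on
`(boolUnpair (0 1 w)).2 = w` with `coinLen_A (|0 1 w| - 2) = coinLen_A |w|` coins, so the two
output distributions coincide definitionally. [Goldreich 2001, Prop. 2.2.7 (proof)]
[cite: Goldreich2001, Prop. 2.2.7] -/
theorem invertProbAdv_dropAdvice_nil (f : List Bool → List Bool)
    (A : RandAlg (List Bool) (List Bool)) (n : ℕ) :
    invertProbAdv f ⟨fun z r => A.run (boolUnpair z).2 r, fun m => A.coinLen (m - 2)⟩
      (fun _ => []) n = invertProb f A n := rfl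

/-- The empty advice sequence `n ↦ ε` has polynomially bounded length (bound `0`).
[Goldreich 2001, §1.3.3; Arora–Barak 2009, Def. 6.5] [cite: Goldreich2001, §1.3.3] -/
theorem isPolyLength_nil : IsPolyLength fun _ => [] := ⟨0, fun n => by simp⟩

/-- **Discharge of `IsOneWayNonuniform.isOneWay`** (Goldreich 2001, Prop. 2.2.7: "If `f` is
non-uniformly one-way, then it is one-way. That is, if `f` satisfies Definition 2.2.6, then it
also satisfies Definition 2.2.1."): given a PPT inverter `A`, apply the non-uniform hardness
to the PPT payload adversary (`IsPPT.dropAdvice`) with the empty advice (`isPolyLength_nil`);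
its advised inversion probability is `invertProb f A` (`invertProbAdv_dropAdvice_nil`), which
is therefore negligible. [cite: Goldreich2001, Prop. 2.2.7 (§2.2.5)] -/
theorem IsOneWayNonuniform.isOneWay_holds : IsOneWayNonuniform.isOneWay := by
  intro f h
  refine ⟨h.1, fun A hA => ?_⟩
  have key := h.2 _ hA.dropAdvice (fun _ => []) isPolyLength_nil
  have hfun : invertProbAdv f ⟨fun z r => A.run (boolUnpair z).2 r, fun m => A.coinLen (m - 2)⟩
      (fun _ => []) = invertProb f A :=
    funext fun n => invertProbAdv_dropAdvice_nil f A n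
  rwa [hfun] at key

end Literature.Computability.Cryptography
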